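import Mathlib
import HarnessLib
import Summits.HubbardSuperconductivity.HubbardSuperconductivity.Theorems.KLProgrammeKLRegimeEngineTowerBlockZeroBaseF
import Summits.HubbardSuperconductivity.HubbardSuperconductivity.Theorems.KLProgrammeKLRegimeEngineTowerBlockZeroIncrLevStepFKlEng
import Summits.HubbardSuperconductivity.HubbardSuperconductivity.Theorems.KLProgrammeKLRegimeEngineTowerLevBaseFWgrid

/-!
# Route `KLProgramme` — crux K3 ENGINE (stmt-HubbardSuperconductivity-20437 `KLRegimeEngineV17F2`), stub (b) v2, THE LEVELS PACKAGE (ℓ), located item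
# «(ℓ)-READOUT-F», (R332)(D)(α′) second half ON THE FLOW FRAME: THE TOWER's BASE UNIT LAW AT `(d, d−1)` ON `K_n` FROM THE LEVEL-`0` DATUM, the block-`0`
# step's data DISCHARGED — and the same with the level-`0` datum read from p3's weighted grid step at `(Λ_1, F_0)` (cell gate-hubbard-kl, seat
# gate-hubbard-kl-p3 g22; `baseLawF_blockZero_sharp` (…TowerBlockZeroBaseF) at `K := klFlowFrameU … n` ∘ `blockZeroIncrLevF_le_kitStep_klEng` (…TowerBlockZeroIncrLevStepFKlEng,
# `j := d`) [∘ `baseRowsF_of_wgrid_bigraded` / `klTowerMuLevF_one_le_of_baseRows` at `d := 1` ∘ p3 g20's weighted grid step at `(Λ_1, F_0)`])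

WHY.  closer‴_klEng / the assembly `kernelNormsLevels_all_klEng` read the re-based tower's BASE DATUM (`𝒱_d[K_n]` at `F_{d−1}`) from p3's grid step at
`(Λ_d, F_{d−1})` — the input «base grid-step rows at (Λ_d, F_{d−1})» of (R332)(C), whose weighted overlap rows of `E(F_{d−1}[K_n])·S_{4M}` are in the located class
(p3 g21, STATUS l.10537).  Here the base datum's unit law is produced instead from the LEVEL-`0` datum: `N_b := klTowerMeasLev … d 1` (honest supremum;
`klTowerMeasLev_one_baseRows` gives `hNb0`/`hcar` for free) obeys `N_b t p / klLevUnitF … t p (d−1) ≤ A_tot·λ^{p−1}·Q_tot^p` for every `p ≥ 3`, where the inputs are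
the level-`0` rows (or, in §2, p3's grid-step rows at `(Λ_1, F_0)` — the SAME class as RO-3's level `0`), the two imports, the five smallness rows at `λ`, the caps,
and `Z^{K_n}_{Λ_1} ≠ 0`; the thick block `(Λ_d, Λ_1]`'s eight data are discharged from the model (`linkDataBlockZeroF_klEng` inside `blockZeroIncrLevF_le_kitStep_klEng`).
With this row as `hlawb` (and `(A_b′, Q_b) := (A_tot, Q_tot)`), the law / RO-4‴ / closer‴ chains can be keyed on `klTowerBLevF_le_law_lev_of_doors_of_le_B`'s
abstract base rows instead of the `(Λ_d, F_{d−1})` grid rows — every grid-row input of the levels package then sits at the family `F_0`.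

* §1 **`baseLawF_blockZeroF_klEng (d c″)`** — level-`0` datum as rows; * §2 **`baseLawF_blockZeroF_klEng_of_wgridStep (d c″)`** — level-`0` datum from the grid step.
Composition of landed theorems and real algebra; nothing about the model is asserted beyond them; nothing asserts (ℓ), any stub, K3 or superconductivity.
References: BGM 2006 §2.8 (2.76)–(2.84), (2.93)–(2.98), Lemma 2.5, §3 (3.2)–(3.8) [cite: BenfattoGiulianiMastropietro2006]; Pedra–Salmhofer 2008 Thm 2.4
[cite: PedraSalmhofer2008].
-/

noncomputable section

namespace Summit.HubbardSuperconductivity.HubbardSuperconductivity.Theorems.EngineV8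

set_option linter.dupNamespace false -- summit = problem name (single-conjunct summit), D-0017

open Classical
open Real Finset Literature.MathematicalPhysics.QuantumLattice Literature.Probability.LatticeModels GrassmannAlgebra
open Literature.Probability.LatticeModels.BattleFederbush
open Literature.MathematicalPhysics.QuantumLattice.FermiRG
open Summit.HubbardSuperconductivity.HubbardSuperconductivity.Theorems.KLProgrammeLegKernels
open Summit.HubbardSuperconductivity.HubbardSuperconductivity.Theorems.KLRegimeSplit
open Summit.HubbardSuperconductivity.HubbardSuperconductivity.Theorems.KLRegimeWick
open Summit.HubbardSuperconductivity.HubbardSuperconductivity.Theorems.TorusFourierL2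
open Summit.HubbardSuperconductivity.HubbardSuperconductivity.Theorems.DispersionFlow

variable {L M : ℕ} [NeZero L] [NeZero M]

/-! ## §1 The base unit law on the flow frame, level-`0` datum as rows -/

set_option maxHeartbeats 400000 in -- one ~80-binder composition
/-- **THE TOWER's BASE UNIT LAW AT `(d, d−1)` ON THE FLOW FRAME FROM THE LEVEL-`0` DATUM, THICK-BLOCK DATA DISCHARGED** ((α′) «M6's base datum at `d − 1`»):
`baseLawF_blockZero_sharp` at `K_n` with its born-step row supplied by `blockZeroIncrLevF_le_kitStep_klEng` at `j := d` (constants pinned by equations, `rfl` at the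
call; `2 ≤ d ≤ n`; `λ > 0` arbitrary).  Conclusion: `klTowerMeasLev … (K_n) d 1 (2p) (t+1) / klLevUnitF β M t p (d−1) ≤ A_tot·λ^{p−1}·Q_tot^p` for every `t` and every
`p ≥ 3`. [cite: BenfattoGiulianiMastropietro2006, §2.8 (2.76)-(2.84), (2.93)-(2.98), §3 (3.2)-(3.8)] -/
theorem baseLawF_blockZeroF_klEng (d : ℕ) (c'' : ℝ) (hc'' : 0 < c'') :
    ∃ Cinc Dinc : ℝ, 1 ≤ Cinc ∧ 1 ≤ Dinc ∧
    ∀ R : RenConsts, R.WF2 → ∃ c₃' : ℝ, 0 < c₃' ∧ ∃ U₀' : ℝ, 0 < U₀' ∧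
      ∃ Cκ Cb CJ : ℝ, 0 < Cκ ∧ 0 < Cb ∧ 0 < CJ ∧
      ∀ (G : GeoConsts) (P : SplitConsts) (Qh : EngConsts) (c : ℝ), P.WF → 0 < c → c ≤ klEngC₃6 P R → c ≤ c₃' →
      ∀ μ ∈ klWindowC, ∀ U : ℝ, 0 < U → U ≤ klEngU₀9 P R c → U ≤ U₀' → c'' * U ≤ 1 → ∀ β : ℝ, klBetaMin ≤ β → β ≤ Real.exp (c / U ^ 2) →
      ∀ (L M : ℕ) [NeZero L] [NeZero M], klEngL₃ β U ≤ L → klEngM₃ β U L ≤ M →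
      ∀ n : ℕ, 1 ≤ n → n ≤ nScales β + 1 → IsKLRegime U c (-(n : ℤ)) →
        HistP klPredsV17F2 L M G P Qh R β U μ 0 n → FrameOK R U (nScales β) μ (klFlowFrameU L M β U μ n) →
        (∀ m, 1 ≤ m → m < n → FlowPieceOscAt L M c'' β U μ m) →
      -- the block length `2 ≤ d ≤ n`, the degree cap and the field cap
      2 ≤ d → d ≤ n → ∀ D : ℕ, 3 ≤ D → Fintype.card (HubbardFieldIdx L M) ≤ 2 * D + 1 →
      hubbardEffPartitionFnCT L M β U μ 0 (klFlowFrameU L M β U μ n) (klScale klE0 1) ≠ 0 →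
      ∀ (lam Ab Qb : ℝ), 0 < lam → 0 ≤ Ab → 0 ≤ Qb →
      -- the level-`0` datum: `𝒱_1[K_n]` at `F_0` and its unit law at `J = 0`, at `λ`
      ∀ Nb : Fin 5 → ℕ → ℝ, (∀ t p, 0 ≤ Nb t p) →
        (∀ (t : Fin 5) (p : ℕ) (Ωe' : Fin (2 * p) → Option (SectorLeg (sectorCount 0))), levelCount Ωe' = (t : ℕ) + 1 →
          klLevNormOf L M β μ (klFlowFrameU L M β U μ n) 0 (2 * p) (klTowerInput L M β U μ (klFlowFrameU L M β U μ n) 1 1) Ωe' ≤ Nb t p) →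
        (∀ (t : Fin 5) (p : ℕ), 3 ≤ p → Nb t p / klLevUnitF β M t p 0 ≤ Ab * lam ^ (p - 1) * Qb ^ p) →
      Fintype.card (SpaceTimeIdx L M × SectorLeg (sectorCount 0)) / 2 ≤ D →
      -- the thick-block data DISCHARGED: the four constants pinned, then the law's six names pinned (equational binders)
      ∀ (κb αb crb ccb : ℝ), κb = Real.sqrt (2 * Cκ * klE0) → αb = Cb * ((M : ℝ) / β) * (4 : ℝ) ^ d / klE0 →
        crb = 81 * CJ * M / β → ccb = 162 * CJ * M / β →
      ∀ (W Z σ Φ ψ τ : ℝ), W = 64 * (27 : ℝ) ^ 4 * exp 2 * crb / ccb → Z = exp 4 * ccb ^ 2 * imagTimeWeight β M ^ 2 / 8 →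
        σ = κb ^ 2 / (exp 4 * ccb ^ 2) → Φ = 9 * αb * ccb / ((27 : ℝ) ^ 5 * exp 1 * κb ^ 2 * crb) → ψ = exp 4 * ccb ^ 2 / κb ^ 2 →
        τ = exp 2 * κb ^ 2 / ccb ^ 2 →
      -- the Chernoff data of the level-`0` datum in floor units and the imports, at `λ`
      ∀ (A' Q' ι₁ ι₂ ι₃ : ℝ), 0 ≤ A' → 0 < Q' →
      (∀ m, 4 ≤ m → m ≤ D → W * Z ^ m * klTowerMuLevF L M β U μ (klFlowFrameU L M β U μ n) 1 1 m ≤ A' * lam ^ (m - 1) * Q' ^ m) →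
      W * Z ^ 3 * klTowerMuLevF L M β U μ (klFlowFrameU L M β U μ n) 1 1 3 ≤ ι₃ * lam ^ 2 →
      W * Z ^ 1 * klTowerMuLevF L M β U μ (klFlowFrameU L M β U μ n) 1 1 1 ≤ ι₁ * lam →
      W * Z ^ 2 * klTowerMuLevF L M β U μ (klFlowFrameU L M β U μ n) 1 1 2 ≤ ι₂ * lam →
      -- the five smallness rows at `(A′, Q′, λ)`
      4 * σ * lam * Q' < 1 → 2 * lam * τ * Q' ≤ 1 → exp 1 * τ * lam * Q' < 1 →
      Φ * (τ * (ι₁ * lam + ι₂ / (2 * Q') + ι₃ / (4 * Q' ^ 2) + A' * Q' / 4)) < 1 →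
      Φ * (exp 1 * τ * (ι₁ * lam) + (exp 1 * τ) ^ 2 * (ι₂ * lam) + (exp 1 * τ) ^ 3 * (ι₃ * lam ^ 2) +
        A' * (exp 1 * τ * Q') * ((exp 1 * τ * lam * Q') ^ 3 / (1 - exp 1 * τ * lam * Q'))) < 1 →
      -- the read-out constants (equational binders)
      ∀ (Aro Qro Qtot Atot : ℝ), Aro = Cinc * Ab → Qro = Dinc * Qb → Qtot = Dinc * max 1 (max Qro (max (4 * Q') (2 * τ * ψ * Q'))) →
        Atot = Aro + Cinc * (A' * (4 * σ * lam * Q' / (1 - 4 * σ * lam * Q')) +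
          exp 1 * (τ * (ι₁ * lam + ι₂ / (2 * Q') + ι₃ / (4 * Q' ^ 2) + A' * Q' / 4)) *
            (Φ * (τ * (ι₁ * lam + ι₂ / (2 * Q') + ι₃ / (4 * Q' ^ 2) + A' * Q' / 4)) /
              (1 - Φ * (τ * (ι₁ * lam + ι₂ / (2 * Q') + ι₃ / (4 * Q' ^ 2) + A' * Q' / 4)))) / (2 * τ * Q')) →
      ∀ (t : Fin 5) (p : ℕ), 3 ≤ p →
        klTowerMeasLev L M β U μ (klFlowFrameU L M β U μ n) d 1 (2 * p) ((t : ℕ) + 1) / klLevUnitF β M t p (d - 1) ≤ Atot * lam ^ (p - 1) * Qtot ^ p := by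
  obtain ⟨Cinc, Dinc, hCinc, hDinc, hF⟩ := baseLawF_blockZero_sharp
  refine ⟨Cinc, Dinc, hCinc, hDinc, fun R hR2 => ?_⟩
  obtain ⟨c₃, hc₃, U₀, hU₀, hF'⟩ := hF R hR2
  obtain ⟨Cκ, Cb, CJ, hCκ, hCb, hCJ, hS⟩ := blockZeroIncrLevF_le_kitStep_klEng d R c'' hc''
  refine ⟨c₃, hc₃, U₀, hU₀, Cκ, Cb, CJ, hCκ, hCb, hCJ, ?_⟩
  intro G P Qh c hP hc hc6 hc₃' μ hμ U hU hU9 hU₀' hcU β hβmin hβc L M _ _ hL3 hM3 n hn1 hnN hreg hhist hfr hosc hd hdn D hD3 hcard hZ1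
    lam Ab Qb hlam hAb hQb Nb hNb0 hcar hlawb hDcap κb αb crb ccb hκb hαb hcrb hccb W Z σ Φ ψ τ hW hZ hσ hΦ hψ hτ
    A' Q' ι₁ ι₂ ι₃ hA'0 hQ'0 hprof hprof3 himp₁ himp₂ hx₁ hx₂ hx₃ hy hθ Aro Qro Qtot Atot hAro hQro hQtot hAtot t p hp
  have he : (0 : ℝ) < klE0 := by norm_num [klE0]
  have hβ : 0 < β := KLRegimeSplit.pos_of_klBetaMin_le hβmin
  have hM0 : (0 : ℝ) < M := Nat.cast_pos.2 (Nat.pos_of_ne_zero (NeZero.ne M))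
  have hdN : d - 1 ≤ nScales β + 1 := by omega
  -- positivity of the pinned constants
  have hκb0 : 0 < κb := by rw [hκb]; exact Real.sqrt_pos.2 (by positivity)
  have hαb0 : 0 < αb := by rw [hαb]; positivity
  have hcrb0 : 0 < crb := by rw [hcrb]; positivity
  have hccb0 : 0 < ccb := by rw [hccb]; positivity
  have hW0 : 0 < W := by rw [hW]; positivity
  have hZ0 : 0 < Z := by rw [hZ]; exact div_pos (mul_pos (mul_pos (exp_pos 4) (pow_pos hccb0 2)) (pow_pos (imagTimeWeight_pos_of_pos (M := M) hβ) 2)) (by norm_num)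
  have hσ0 : 0 ≤ σ := by rw [hσ]; positivity
  have hΦ0 : 0 ≤ Φ := by rw [hΦ]; positivity
  have hψ0 : 0 ≤ ψ := by rw [hψ]; positivity
  have hτ0 : 0 < τ := by rw [hτ]; positivity
  -- the block-`0` born step on `K_n` at `j := d`, data discharged
  have hstep := hS G P Qh c hP hR2 hc hc6 μ hμ U hU hU9 hcU β hβmin hβc L M hL3 hM3 n hn1 hnN hreg hhist hfr hosc d (by omega) le_rfl hdn hZ1 D hDcap
    κb αb crb ccb hκb hαb hcrb hccb
  have hborn : ∀ N : ℕ, 1 ≤ N → Φ * towerV D τ (fun m => W * Z ^ m * klTowerMuLevF L M β U μ (klFlowFrameU L M β U μ n) 1 1 m) < 1 →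
      ∀ (t : Fin 5) (q : ℕ) (Ωe : Fin (2 * q + 1 + 1) → Option (SectorLeg (sectorCount 1))), levelCount Ωe = (t : ℕ) + 1 →
      klLevNormOf L M β μ (klFlowFrameU L M β U μ n) 1 (2 * q + 1 + 1)
          (klEffectiveAction L M β U μ (klFlowFrameU L M β U μ n) klE0 d - klTowerInput L M β U μ (klFlowFrameU L M β U μ n) 1 1) Ωe /
          klLevUnitF β M t (q + 1) 1 ≤
        towerFO D σ (fun m => W * Z ^ m * klTowerMuLevF L M β U μ (klFlowFrameU L M β U μ n) 1 1 m) (q + 1) +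
          ∑ n' ∈ Icc 2 N, exp 1 * Φ ^ (n' - 1) * ψ ^ (q + 1) *
            towerS D τ (fun m => W * Z ^ m * klTowerMuLevF L M β U μ (klFlowFrameU L M β U μ n) 1 1 m) n' (q + 1) +
          ψ ^ (q + 1) * exp 1 * towerV D τ (fun m => W * Z ^ m * klTowerMuLevF L M β U μ (klFlowFrameU L M β U μ n) 1 1 m) *
            (Φ * towerV D τ (fun m => W * Z ^ m * klTowerMuLevF L M β U μ (klFlowFrameU L M β U μ n) 1 1 m)) ^ N /
            (1 - Φ * towerV D τ (fun m => W * Z ^ m * klTowerMuLevF L M β U μ (klFlowFrameU L M β U μ n) 1 1 m)) := by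
    subst hW hZ hσ hΦ hψ hτ
    exact hstep
  exact hF' P c hP hc hc6 hc₃' μ hμ U hU hU9 hU₀' β hβmin hβc (klFlowFrameU L M β U μ n) hfr L M hL3 hM3 d D hd hdN hD3 hcard lam Ab Qb hlam hAb hQb
    Nb hNb0 hcar hlawb W Z σ Φ ψ τ A' Q' ι₁ ι₂ ι₃ hW0 hZ0 hσ0 hΦ0 hψ0 hτ0 hA'0 hQ'0 hprof hprof3 himp₁ himp₂ hx₁ hx₂ hx₃ hy hθ hborn
    Aro Qro Qtot Atot hAro hQro hQtot hAtot t p hp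

/-! ## §2 The base unit law on the flow frame, level-`0` datum from p3's weighted grid step at `(Λ_1, F_0)` -/

set_option maxHeartbeats 400000 in -- one ~80-binder composition + the grid-step budget algebra
/-- **THE TOWER's BASE UNIT LAW AT `(d, d−1)` ON THE FLOW FRAME, THE LEVEL-`0` DATUM READ FROM p3's WEIGHTED GRID STEP AT `(Λ_1, F_0)`**: §1 with the base rows
and the profile rows DISCHARGED from the grid-step hypotheses at the cutoff `Λ_1`, analysis family `F_0`, rate `jw` (derived constants `nV cF cg Ag Pg` and the choices
`A_b = A_g/Klam²`, `Q_b = P_g`, `A_b′ = A_b/B²`, `A′ = 27⁵·W·A_b′`, `Q′ = Z·Q_b`, `ι₃ = A′·Q′³` equational, `rfl` at the call; `λ = B·ε` with `B·Klam·|U| ≤ λ` is needed by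
the discount, so here `λ := B·epsCoupling P U j` at a level `j` of the consumer's choice).
[cite: BenfattoGiulianiMastropietro2006, §2.8 (2.83), (2.93)-(2.98), §3 (3.2)-(3.8)] -/
theorem baseLawF_blockZeroF_klEng_of_wgridStep (d : ℕ) (c'' : ℝ) (hc'' : 0 < c'') :
    ∃ Cinc Dinc : ℝ, 1 ≤ Cinc ∧ 1 ≤ Dinc ∧
    ∀ R : RenConsts, R.WF2 → ∃ c₃' : ℝ, 0 < c₃' ∧ ∃ U₀' : ℝ, 0 < U₀' ∧
      ∃ Cκ Cb CJ : ℝ, 0 < Cκ ∧ 0 < Cb ∧ 0 < CJ ∧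
      ∀ (G : GeoConsts) (P : SplitConsts) (Qh : EngConsts) (c : ℝ), P.WF → 0 < c → c ≤ klEngC₃6 P R → c ≤ c₃' →
      ∀ μ ∈ klWindowC, ∀ U : ℝ, 0 < U → U ≤ klEngU₀9 P R c → U ≤ U₀' → c'' * U ≤ 1 → ∀ β : ℝ, klBetaMin ≤ β → β ≤ Real.exp (c / U ^ 2) →
      ∀ (L M : ℕ) [NeZero L] [NeZero M], klEngL₃ β U ≤ L → klEngM₃ β U L ≤ M →
      ∀ n : ℕ, 1 ≤ n → n ≤ nScales β + 1 → IsKLRegime U c (-(n : ℤ)) →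
        HistP klPredsV17F2 L M G P Qh R β U μ 0 n → FrameOK R U (nScales β) μ (klFlowFrameU L M β U μ n) →
        (∀ m, 1 ≤ m → m < n → FlowPieceOscAt L M c'' β U μ m) →
      2 ≤ d → d ≤ n → ∀ D : ℕ, 3 ≤ D → Fintype.card (HubbardFieldIdx L M) ≤ 2 * D + 1 →
      hubbardEffPartitionFnCT L M β U μ 0 (klFlowFrameU L M β U μ n) (klScale klE0 1) ≠ 0 →
      ∀ (j : ℕ) (B : ℝ), 1 ≤ B →
      -- p3's weighted grid step hypotheses at the cutoff `Λ_1`, analysis family `F_0`, rate `jw`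
      ∀ (jw : ℕ) (κ : ℝ), 0 < κ →
        IsGramBoundedR ((hubbardGridSub L M β (2 * (2 * M))).transpose * hubbardCovAboveCT L M β μ 0 (klFlowFrameU L M β U μ n) (klScale klE0 1) *
          hubbardGridSub L M β (2 * (2 * M))) κ →
      ∀ (αw : ℝ), 0 < αw →
        (∀ X, ∑ Y, ‖((hubbardGridSub L M β (2 * (2 * M))).transpose * hubbardCovAboveCT L M β μ 0 (klFlowFrameU L M β U μ n) (klScale klE0 1) *
          hubbardGridSub L M β (2 * (2 * M))) X Y‖ * gridLabelWt L (2 * (2 * M)) β {gridLegPos X, gridLegPos Y} ≤ αw) →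
        (∀ Y, ∑ X, ‖((hubbardGridSub L M β (2 * (2 * M))).transpose * hubbardCovAboveCT L M β μ 0 (klFlowFrameU L M β U μ n) (klScale klE0 1) *
          hubbardGridSub L M β (2 * (2 * M))) X Y‖ * gridLabelWt L (2 * (2 * M)) β {gridLegPos X, gridLegPos Y} ≤ αw) →
      ∀ (ρ : ℝ), 0 < ρ →
        Real.exp 1 * αw * normV (GridLeg (GridPoint L (2 * (2 * M)))) κ ρ
          (fun m' : ℕ => if m' = 1 then |β| / (2 * (2 * M) : ℕ) * ∑ z : TorusSite 2 L, ‖framePosKernel L (klFlowFrameU L M β U μ n) z‖ * (1 + torusSiteDist z 0)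
            else if m' = 2 then |U| * |β| / (2 * (2 * M) : ℕ) else 0) / κ ^ 2 < 1 →
      ∀ (crw ccw : ℝ), 0 < crw → 0 < ccw →
        (∀ X'' : SpaceTimeIdx L M × SectorLeg (sectorCount 0), ∑ X' : GridLeg (GridPoint L (2 * (2 * M))),
          ‖(sectorAnalysisMatrix L M β (klAnisoFamily L M β μ (klFlowFrameU L M β U μ n) klE0 0) * hubbardGridSub L M β (2 * (2 * M))) X'' X'‖ *
            gridLabelWt L (2 * (2 * M)) β {latticeLegPos (2 * (2 * M)) X'', gridLegPos X'} ≤ crw) →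
        (∀ X' : GridLeg (GridPoint L (2 * (2 * M))), ∑ X'' : SpaceTimeIdx L M × SectorLeg (sectorCount 0),
          ‖(sectorAnalysisMatrix L M β (klAnisoFamily L M β μ (klFlowFrameU L M β U μ n) klE0 0) * hubbardGridSub L M β (2 * (2 * M))) X'' X'‖ *
            gridLabelWt L (2 * (2 * M)) β {latticeLegPos (2 * (2 * M)) X'', gridLegPos X'} ≤ ccw) →
      -- the derived base constants (equational binders)
      ∀ (nV cF cg Ag Pg : ℝ),
        nV = normV (GridLeg (GridPoint L (2 * (2 * M)))) κ ρ
          (fun m' : ℕ => if m' = 1 then |β| / (2 * (2 * M) : ℕ) * ∑ z : TorusSite 2 L, ‖framePosKernel L (klFlowFrameU L M β U μ n) z‖ * (1 + torusSiteDist z 0)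
            else if m' = 2 then |U| * |β| / (2 * (2 * M) : ℕ) else 0) →
        cF = (Real.exp 2 * (κ + ρ)) ^ (2 * 2) * (|β| / (2 * (2 * M) : ℕ)) → cg = Real.exp 1 * αw * cF / κ ^ 2 →
        Ag = crw * Real.exp 1 * cF / (ccw * cg ^ 2) → Pg = ccw ^ 2 * cg / (ρ ^ 2 * (1 - Real.exp 1 * αw * nV / κ ^ 2)) →
      ∀ (Ab Qb Ab' : ℝ), Ab = Ag / P.Klam ^ 2 → Qb = Pg → Ab' = Ab / B ^ 2 →
      Fintype.card (SpaceTimeIdx L M × SectorLeg (sectorCount 0)) / 2 ≤ D →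
      ∀ (κb αb crb ccb : ℝ), κb = Real.sqrt (2 * Cκ * klE0) → αb = Cb * ((M : ℝ) / β) * (4 : ℝ) ^ d / klE0 →
        crb = 81 * CJ * M / β → ccb = 162 * CJ * M / β →
      ∀ (W Z σ Φ ψ τ : ℝ), W = 64 * (27 : ℝ) ^ 4 * exp 2 * crb / ccb → Z = exp 4 * ccb ^ 2 * imagTimeWeight β M ^ 2 / 8 →
        σ = κb ^ 2 / (exp 4 * ccb ^ 2) → Φ = 9 * αb * ccb / ((27 : ℝ) ^ 5 * exp 1 * κb ^ 2 * crb) → ψ = exp 4 * ccb ^ 2 / κb ^ 2 →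
        τ = exp 2 * κb ^ 2 / ccb ^ 2 →
      ∀ (A' Q' ι₃ ι₁ ι₂ : ℝ), A' = (27 : ℝ) ^ 5 * W * Ab' → Q' = Z * Qb → ι₃ = A' * Q' ^ 3 →
      W * Z ^ 1 * klTowerMuLevF L M β U μ (klFlowFrameU L M β U μ n) 1 1 1 ≤ ι₁ * (B * epsCoupling P U j) →
      W * Z ^ 2 * klTowerMuLevF L M β U μ (klFlowFrameU L M β U μ n) 1 1 2 ≤ ι₂ * (B * epsCoupling P U j) →
      4 * σ * (B * epsCoupling P U j) * Q' < 1 → 2 * (B * epsCoupling P U j) * τ * Q' ≤ 1 → exp 1 * τ * (B * epsCoupling P U j) * Q' < 1 →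
      Φ * (τ * (ι₁ * (B * epsCoupling P U j) + ι₂ / (2 * Q') + ι₃ / (4 * Q' ^ 2) + A' * Q' / 4)) < 1 →
      Φ * (exp 1 * τ * (ι₁ * (B * epsCoupling P U j)) + (exp 1 * τ) ^ 2 * (ι₂ * (B * epsCoupling P U j)) +
          (exp 1 * τ) ^ 3 * (ι₃ * (B * epsCoupling P U j) ^ 2) +
        A' * (exp 1 * τ * Q') * ((exp 1 * τ * (B * epsCoupling P U j) * Q') ^ 3 / (1 - exp 1 * τ * (B * epsCoupling P U j) * Q'))) < 1 →
      ∀ (Aro Qro Qtot Atot : ℝ), Aro = Cinc * Ab' → Qro = Dinc * Qb → Qtot = Dinc * max 1 (max Qro (max (4 * Q') (2 * τ * ψ * Q'))) →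
        Atot = Aro + Cinc * (A' * (4 * σ * (B * epsCoupling P U j) * Q' / (1 - 4 * σ * (B * epsCoupling P U j) * Q')) +
          exp 1 * (τ * (ι₁ * (B * epsCoupling P U j) + ι₂ / (2 * Q') + ι₃ / (4 * Q' ^ 2) + A' * Q' / 4)) *
            (Φ * (τ * (ι₁ * (B * epsCoupling P U j) + ι₂ / (2 * Q') + ι₃ / (4 * Q' ^ 2) + A' * Q' / 4)) /
              (1 - Φ * (τ * (ι₁ * (B * epsCoupling P U j) + ι₂ / (2 * Q') + ι₃ / (4 * Q' ^ 2) + A' * Q' / 4)))) / (2 * τ * Q')) →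
      ∀ (t : Fin 5) (p : ℕ), 3 ≤ p →
        klTowerMeasLev L M β U μ (klFlowFrameU L M β U μ n) d 1 (2 * p) ((t : ℕ) + 1) / klLevUnitF β M t p (d - 1) ≤
          Atot * (B * epsCoupling P U j) ^ (p - 1) * Qtot ^ p := by
  obtain ⟨Cinc, Dinc, hCinc, hDinc, hF⟩ := baseLawF_blockZeroF_klEng d c'' hc''
  refine ⟨Cinc, Dinc, hCinc, hDinc, fun R hR2 => ?_⟩
  obtain ⟨c₃, hc₃, U₀, hU₀, Cκ, Cb, CJ, hCκ, hCb, hCJ, hF'⟩ := hF R hR2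
  refine ⟨c₃, hc₃, U₀, hU₀, Cκ, Cb, CJ, hCκ, hCb, hCJ, ?_⟩
  intro G P Qh c hP hc hc6 hc₃' μ hμ U hU hU9 hU₀' hcU β hβmin hβc L M _ _ hL3 hM3 n hn1 hnN hreg hhist hfr hosc hd hdn D hD3 hcard hZ1 j B hB
    jw κ hκ hGB αw hαw hrow hcol ρ hρ hθ crw ccw hcrw hccw hrow' hcol' nV cF cg Ag Pg hnV hcF hcg hAg hPg Ab Qb Ab' hAb hQb hAb' hDcap
    κb αb crb ccb hκb hαb hcrb hccb W Z σ Φ ψ τ hW hZ hσ hΦ hψ hτ A' Q' ι₃ ι₁ ι₂ hA' hQ' hι₃ himp₁ himp₂ hx₁ hx₂ hx₃ hy hθ'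
    Aro Qro Qtot Atot hAro hQro hQtot hAtot t p hp
  set K : TrigPolyC4v := klFlowFrameU L M β U μ n with hKdef
  have hβ : 0 < β := KLRegimeSplit.pos_of_klBetaMin_le hβmin
  have hε : 0 ≤ imagTimeWeight β M := imagTimeWeight_nonneg hβ.le M
  have hM0 : (0 : ℝ) < M := Nat.cast_pos.2 (Nat.pos_of_ne_zero (NeZero.ne M))
  have hK1 : 1 ≤ P.Klam := hP.1
  have hK0 : 0 < P.Klam := lt_of_lt_of_le one_pos hK1
  have hB0 : 0 < B := lt_of_lt_of_le one_pos hB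
  have hBK : 1 ≤ B * P.Klam := one_le_mul_of_one_le_of_one_le hB hK1
  have hεj : 0 < epsCoupling P U j := by
    unfold epsCoupling
    have : 0 < |U| + U ^ 2 * (j : ℝ) := by positivity
    positivity
  set lam : ℝ := B * epsCoupling P U j with hlamdef
  have hlam : 0 < lam := mul_pos hB0 hεj
  have hle : B * P.Klam * |U| ≤ lam := by
    rw [hlamdef]
    unfold epsCoupling
    have h1 : |U| ≤ |U| + U ^ 2 * (j : ℝ) := le_add_of_nonneg_right (by positivity)
    calc B * P.Klam * |U| = B * (P.Klam * |U|) := by ring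
      _ ≤ B * (P.Klam * (|U| + U ^ 2 * (j : ℝ))) := mul_le_mul_of_nonneg_left (mul_le_mul_of_nonneg_left h1 hK0.le) hB0.le
  -- (1) p3's literal degree budget at `(Λ_1, F_0)` and its bi-graded reading (verbatim as …TowerLevBaseFWgrid, at `d := 1`)
  have hMpos : (0 : ℝ) < (2 * (2 * M) : ℕ) := by
    have := NeZero.ne M
    exact_mod_cast (by omega : 0 < 2 * (2 * M))
  have hθw : Real.exp 1 * αw * nV / κ ^ 2 < 1 := by rw [hnV]; exact hθ
  have hnV0 : 0 ≤ nV := by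
    rw [hnV]
    refine normV_nonneg hκ.le hρ.le (fun m' => ?_)
    split_ifs
    · exact mul_nonneg (by positivity) (sum_nonneg fun z _ => mul_nonneg (norm_nonneg _)
        (add_nonneg zero_le_one (by unfold torusSiteDist; exact Nat.cast_nonneg _)))
    · positivity
    · exact le_rfl
  set f : ℝ := (Real.exp 2 * (κ + ρ)) ^ (2 * 2) * (|U| * |β| / (2 * (2 * M) : ℕ)) with hfdef
  have hf0 : 0 ≤ f := by positivity
  have hcF0 : 0 < cF := by rw [hcF]; have := abs_pos.2 hβ.ne'; positivity
  have hfu : f = cF * |U| := by rw [hfdef, hcF]; ring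
  have h1θ : 0 < 1 - Real.exp 1 * αw * nV / κ ^ 2 := sub_pos.2 hθw
  obtain ⟨Nlit, hNlit⟩ : ∃ Nlit : ℕ → ℝ, Nlit = fun m =>
      if m = 2 then imagTimeWeight β M ^ (2 - 1) * (crw * ccw ^ (2 - 1) * (ρ⁻¹ ^ 2 * (Real.exp 1 * nV) / (1 - Real.exp 1 * αw * nV / κ ^ 2)))
      else if Even m ∧ 4 ≤ m then
        imagTimeWeight β M ^ (2 * (m / 2) - 1) * (crw * ccw ^ (2 * (m / 2) - 1) *
          (ρ⁻¹ ^ (2 * (m / 2)) * (Real.exp 1 * f) * (Real.exp 1 * αw * f / κ ^ 2) ^ (m / 2 - 2) / (1 - Real.exp 1 * αw * nV / κ ^ 2) ^ (m / 2)))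
      else 0 := ⟨_, rfl⟩
  have hNlit_two : Nlit 2 = imagTimeWeight β M ^ (2 - 1) * (crw * ccw ^ (2 - 1) * (ρ⁻¹ ^ 2 * (Real.exp 1 * nV) / (1 - Real.exp 1 * αw * nV / κ ^ 2))) := by
    rw [hNlit]; simp
  have hNlit_mul : ∀ p, 2 ≤ p → Nlit (2 * p) = imagTimeWeight β M ^ (2 * p - 1) * (crw * ccw ^ (2 * p - 1) *
      (ρ⁻¹ ^ (2 * p) * (Real.exp 1 * f) * (Real.exp 1 * αw * f / κ ^ 2) ^ (p - 2) / (1 - Real.exp 1 * αw * nV / κ ^ 2) ^ p)) := by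
    intro p hp
    have h2 : 2 * p ≠ 2 := by omega
    have hev : Even (2 * p) ∧ 4 ≤ 2 * p := ⟨even_two_mul p, by omega⟩
    rw [hNlit]
    simp only [h2, if_false, hev, and_self, if_true, Nat.mul_div_cancel_left p two_pos]
  have hNlit0 : ∀ m, 0 ≤ Nlit m := by
    intro m
    rw [hNlit]
    dsimp only
    split_ifs
    · positivity
    · positivity
    · exact le_rfl
  set Nw : ℕ → ℝ := fun p => Nlit (2 * p) with hNwdef
  have hNw0 : ∀ p, 0 ≤ Nw p := fun p => hNlit0 _
  have hp3 := klWtPinnedSumAt_klEffectiveAction_fam_le_of_wgridStep hβ U μ K 1 0 jw hκ hGB hαw hrow hcol hρ hθ hccw.le hrow' hcol'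
    Nlit (fun m _ => hNlit0 m) (by rw [hNlit_two, hnV]) (fun p hp => by rw [hNlit_mul p hp, hnV])
  have hgrid : ∀ p, 1 ≤ p → ∀ (q : Fin (2 * p)) (w : SpaceTimeIdx L M × SectorLeg (sectorCount (1 - 1))),
      klWtPinnedSumAt L M β μ K (1 - 1) jw (2 * p) (klTowerInput L M β U μ K 1 1) q w ≤ Nw p := by
    intro p _ q w
    unfold klTowerInput
    exact hp3 (2 * p) q w
  have hcg0 : 0 < cg := by rw [hcg]; positivity
  have hAg0 : 0 < Ag := by rw [hAg]; positivity
  have hPg0 : 0 < Pg := by rw [hPg]; positivity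
  have hbi : ∀ p, 3 ≤ p → Nw p ≤ imagTimeWeight β M ^ (2 * p - 1) * Ag * Pg ^ p * |U| ^ (p - 1) := by
    intro p hp
    have h := wgridBudget_bigraded_le (crw := crw) (θ := Real.exp 1 * αw * nV / κ ^ 2) hccw.le hρ hκ hαw hθw hcF0 hfu (by omega : 2 ≤ p)
    rw [← hcg, ← hAg, ← hPg] at h
    calc Nw p = Nlit (2 * p) := rfl
      _ = imagTimeWeight β M ^ (2 * p - 1) * (crw * ccw ^ (2 * p - 1) *
          (ρ⁻¹ ^ (2 * p) * (Real.exp 1 * f) * (Real.exp 1 * αw * f / κ ^ 2) ^ (p - 2) / (1 - Real.exp 1 * αw * nV / κ ^ 2) ^ p)) :=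
          hNlit_mul p (by omega)
      _ ≤ imagTimeWeight β M ^ (2 * p - 1) * (Ag * Pg ^ p * |U| ^ (p - 1)) := mul_le_mul_of_nonneg_left h (pow_nonneg hε _)
      _ = imagTimeWeight β M ^ (2 * p - 1) * Ag * Pg ^ p * |U| ^ (p - 1) := by ring
  -- (2) the base rows of `𝒱_1` at `F_0` (`d := 1`), and the profile of the floor array `klTowerMuLevF … 1 1`
  obtain ⟨hNb0, hcar, hlawb⟩ := baseRowsF_of_wgrid_bigraded (L := L) (M := M) hβ U μ K 1 jw Nw hNw0 hgrid hAg0.le hPg0.le hbi hK0 hBK hle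
  have hAb'0 : 0 ≤ Ab' := by rw [hAb', hAb]; positivity
  have hQb0 : 0 ≤ Qb := by rw [hQb]; exact hPg0.le
  have hlawb' : ∀ (t : Fin 5) (p : ℕ), 3 ≤ p → (fun (_ : Fin 5) (p : ℕ) => Nw p) t p / klLevUnitF β M t p 0 ≤ Ab' * lam ^ (p - 1) * Qb ^ p := by
    intro t p hp
    have h := hlawb t p hp
    simp only [Nat.sub_self, Nat.mul_zero, pow_zero, one_mul, div_one] at h
    rw [hAb', hAb, hQb]
    exact h
  have hcar' : ∀ (t : Fin 5) (p : ℕ) (Ωe' : Fin (2 * p) → Option (SectorLeg (sectorCount 0))), levelCount Ωe' = (t : ℕ) + 1 →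
      klLevNormOf L M β μ K 0 (2 * p) (klTowerInput L M β U μ K 1 1) Ωe' ≤ (fun (_ : Fin 5) (p : ℕ) => Nw p) t p := hcar
  have hmuF : ∀ m, 3 ≤ m → klTowerMuLevF L M β U μ K 1 1 m ≤ (27 : ℝ) ^ 5 * Ab' * lam ^ (m - 1) * Qb ^ m := fun m hm =>
    klTowerMuLevF_one_le_of_baseRows hβ U μ K 1 hlam.le hAb'0 hQb0 _ hNb0 hcar' hlawb' hm
  -- positivity of the pinned constants, the profile rows in the law's shape
  have hcrb0 : 0 < crb := by rw [hcrb]; positivity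
  have hccb0 : 0 < ccb := by rw [hccb]; positivity
  have hW0 : 0 < W := by rw [hW]; positivity
  have hZ0 : 0 < Z := by rw [hZ]; exact div_pos (mul_pos (mul_pos (exp_pos 4) (pow_pos hccb0 2)) (pow_pos (imagTimeWeight_pos_of_pos (M := M) hβ) 2)) (by norm_num)
  have hA'0 : 0 ≤ A' := by rw [hA']; positivity
  have hQ'0 : 0 < Q' := by rw [hQ', hQb]; positivity
  have hprof : ∀ m, 4 ≤ m → m ≤ D → W * Z ^ m * klTowerMuLevF L M β U μ K 1 1 m ≤ A' * lam ^ (m - 1) * Q' ^ m := by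
    intro m hm _
    calc W * Z ^ m * klTowerMuLevF L M β U μ K 1 1 m ≤ W * Z ^ m * ((27 : ℝ) ^ 5 * Ab' * lam ^ (m - 1) * Qb ^ m) :=
          mul_le_mul_of_nonneg_left (hmuF m (by omega)) (by positivity)
      _ = A' * lam ^ (m - 1) * Q' ^ m := by rw [hA', hQ', mul_pow]; ring
  have hprof3 : W * Z ^ 3 * klTowerMuLevF L M β U μ K 1 1 3 ≤ ι₃ * lam ^ 2 := by
    calc W * Z ^ 3 * klTowerMuLevF L M β U μ K 1 1 3 ≤ W * Z ^ 3 * ((27 : ℝ) ^ 5 * Ab' * lam ^ (3 - 1) * Qb ^ 3) :=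
          mul_le_mul_of_nonneg_left (hmuF 3 le_rfl) (by positivity)
      _ = ι₃ * lam ^ 2 := by rw [hι₃, hA', hQ', mul_pow]; ring
  -- (3) §1
  exact hF' G P Qh c hP hc hc6 hc₃' μ hμ U hU hU9 hU₀' hcU β hβmin hβc L M hL3 hM3 n hn1 hnN hreg hhist hfr hosc hd hdn D hD3 hcard hZ1
    lam Ab' Qb hlam hAb'0 hQb0 (fun (_ : Fin 5) (p : ℕ) => Nw p) hNb0 hcar' hlawb' hDcap κb αb crb ccb hκb hαb hcrb hccb W Z σ Φ ψ τ hW hZ hσ hΦ hψ hτ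
    A' Q' ι₁ ι₂ ι₃ hA'0 hQ'0 hprof hprof3 himp₁ himp₂ hx₁ hx₂ hx₃ hy hθ' Aro Qro Qtot Atot hAro hQro hQtot hAtot t p hp

end Summit.HubbardSuperconductivity.HubbardSuperconductivity.Theorems.EngineV8

end
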